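import Summits.CriticalPhenomena.PercolationContinuityZ3.Theorems.PercNearOneGluingNoHeavyLowerTailStarSetSupplyU1
import Summits.CriticalPhenomena.PercolationContinuityZ3.Theorems.PercNearOneGluingNoHeavyLowerTailStarSetForestSplit
import HarnessLib

/-!
# `NoHeavyLowerTail` (stmt-CriticalPhenomena-4575) — OES at level `j ≤ 2` for EVERY two-port star multigraph (unconditional)

Support file (prover `prim-gen-swap` gen 15; `--supports stmt-CriticalPhenomena-4575`).  No definitions, no named facts, no sorries.

The observer-extension inequality `μ(c ↮ S, 1 ≤ |π(S)| ≤ j) ≤ μ(c ↮ S, |π(c)| ≤ j)` (`j ≤ 2`) for an arbitrary system of two-port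
stars `s i ∼ {p i, p' i}` glued to a port set `A` (observer `c ∈ A` off the ports, every port dominated by `c` at level `j`, the star
centres seeing nothing but their two ports): split the parallel classes of the stars into a spanning forest in leaf-peeling order plus
locally dominated chords (`StarSet.exists_forest_chord_split_surj`, Kruskal), re-orient every star along its class, and apply
`StarSet.setCS_twoPortStarMultigraph_split_levelTwo` (MWF certificate + U0′ + U1′_r, all proved).

* `StarSet.setCS_twoPortStarMultigraph_levelTwo`.
-/

noncomputable section

namespace Summit.CriticalPhenomena.PercolationContinuityZ3.Theorems

open MeasureTheory Set Finset Literature.Probability.LatticeModels Literature.Probability.Percolation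
open scoped Classical BigOperators

variable {n m : ℕ}

namespace StarSet

/-- **OES_{j≤2} for every two-port star multigraph, unconditionally.**
[cite: VandenbergHaggstromKahn2005, Thm. 1.5 (p. 7) — via `observerSet_le_of_lonelier`] [folklore: Kruskal] -/
theorem setCS_twoPortStarMultigraph_levelTwo (w : Sym2 (Fin n) → unitInterval) (A : Finset (Fin n)) (s p p' : Fin m → Fin n)
    (c : Fin n) (j : ℕ) (hj : j ≤ 2) (hs : Function.Injective s) (hsA : ∀ i, s i ∉ A)
    (hpA : ∀ i, p i ∈ A) (hp'A : ∀ i, p' i ∈ A) (hpp' : ∀ i, p i ≠ p' i)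
    (hcA : c ∈ A) (hcp : ∀ i, c ≠ p i ∧ c ≠ p' i)
    (hobs : ∀ i u, u ≠ s i → u ≠ p i → u ≠ p' i → w s(s i, u) = 0)
    (hdom : ∀ i,
      (prodBernoulli w).real {ω : BondConfig (Fin n) | (A.filter fun z => ω ∈ openConn (p i) z).card ≤ j} ≤
          (prodBernoulli w).real {ω : BondConfig (Fin n) | (A.filter fun z => ω ∈ openConn c z).card ≤ j} ∧
        (prodBernoulli w).real {ω : BondConfig (Fin n) | (A.filter fun z => ω ∈ openConn (p' i) z).card ≤ j} ≤
          (prodBernoulli w).real {ω : BondConfig (Fin n) | (A.filter fun z => ω ∈ openConn c z).card ≤ j}) :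
    (prodBernoulli w).real {ω : BondConfig (Fin n) | (∀ x ∈ Finset.univ.image s, ω ∉ openConn c x) ∧
        1 ≤ (A.filter fun z => ∃ x ∈ Finset.univ.image s, ω ∈ openConn x z).card ∧
        (A.filter fun z => ∃ x ∈ Finset.univ.image s, ω ∈ openConn x z).card ≤ j} ≤
      (prodBernoulli w).real {ω : BondConfig (Fin n) | (∀ x ∈ Finset.univ.image s, ω ∉ openConn c x) ∧
        (A.filter fun z => ω ∈ openConn c z).card ≤ j} := by
  obtain ⟨Mf, Mc, cls, P, P', hsurj, hor, hPP', hnopar, hforest, hdomF⟩ :=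
    exists_forest_chord_split_surj p p' hpp' (fun i => (w s(s i, p i) : ℝ) * w s(s i, p' i))
  -- re-orient every star along its class
  obtain ⟨q, q', hq, hq', hqq⟩ : ∃ q q' : Fin m → Fin n, (∀ i, q i = P (cls i)) ∧ (∀ i, q' i = P' (cls i)) ∧
      ∀ i, (q i = p i ∧ q' i = p' i) ∨ (q i = p' i ∧ q' i = p i) :=
    ⟨fun i => P (cls i), fun i => P' (cls i), fun _ => rfl, fun _ => rfl, hor⟩
  have hθ : ∀ i, (w s(s i, q i) : ℝ) * w s(s i, q' i) = (w s(s i, p i) : ℝ) * w s(s i, p' i) := by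
    intro i
    rcases hqq i with ⟨h1, h2⟩ | ⟨h1, h2⟩
    · rw [h1, h2]
    · rw [h1, h2, mul_comm]
  have hports : ∀ I, ∃ i, (P I = p i ∧ P' I = p' i) ∨ (P I = p' i ∧ P' I = p i) := by
    intro I
    obtain ⟨i, hi⟩ := hsurj I
    refine ⟨i, ?_⟩
    rw [← hi, ← hq i, ← hq' i]
    exact hqq i
  refine setCS_twoPortStarMultigraph_split_levelTwo w A s q q' cls P P' hq hq' c j hj hs hsA (fun I => ?_) (fun I => ?_) hPP'
    hnopar hforest hcA (fun I => ?_) (fun i u hu h1 h2 => ?_) (fun I => ?_) (fun K d hd => ?_)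
  · obtain ⟨i, ⟨h, -⟩ | ⟨h, -⟩⟩ := hports I <;> rw [h]
    exacts [hpA _, hp'A _]
  · obtain ⟨i, ⟨-, h⟩ | ⟨-, h⟩⟩ := hports I <;> rw [h]
    exacts [hp'A _, hpA _]
  · obtain ⟨i, ⟨h1, h2⟩ | ⟨h1, h2⟩⟩ := hports I <;> rw [h1, h2]
    exacts [hcp _, ⟨(hcp _).2, (hcp _).1⟩]
  · rcases hqq i with ⟨e1, e2⟩ | ⟨e1, e2⟩
    · exact hobs i u hu (by rw [← e1]; exact h1) (by rw [← e2]; exact h2)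
    · exact hobs i u hu (by rw [← e2]; exact h2) (by rw [← e1]; exact h1)
  · obtain ⟨i, ⟨h1, h2⟩ | ⟨h1, h2⟩⟩ := hports I <;> rw [h1, h2]
    exacts [hdom _, ⟨(hdom _).2, (hdom _).1⟩]
  · obtain ⟨I, h1, h2, h3⟩ := hdomF K d hd
    refine ⟨I, h1, h2, ?_⟩
    simpa only [hθ] using h3

end StarSet

end Summit.CriticalPhenomena.PercolationContinuityZ3.Theorems

end
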